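import Literature.Analysis.FluidPDE.ShearCascadeDrifts
import Literature.Analysis.FluidPDE.CheskidovScalarEstimates
import HarnessLib

/-!
# The shear cascade: inviscid profiles, transport equations, gradient budget

Analysis/FluidPDE support file (everything proved; no named facts). Fourth part of the
alternating near-triangle shear cascade (`ShearCascadeDrifts` and its imports), on the way to
an explicit partial-dissipation family for `CheskidovPartialPeriodisation` (A. Cheskidov,
arXiv:2311.04182, Theorem 1.3, §4 replaced by an explicit cascade). Given the drifts `vel m` of
`ShearCascadeDrifts`, this file provides the *inviscid* side of §4:

* the inviscid profiles `Lst m t` of the `m`-truncated cascade (`L_0 = ρ_in`,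
  `L_{s+1}(t) = L_s(t) ∘ Φ_{s+1}^{a_{s+1}(t)}`), jointly smooth (`isSmoothSpaceTimeOn_Lst`),
  equal to the cascade state `Θ_s` after the last slot (`Lst_eq_Theta`) and to `L_s` before
  slot `s+1` (`Lst_succ_eq_of_le`, `Lst_eq_of_le`);
* **the transport equations** `∂ₜL_m + vel m·∇L_m = 0` on `ℝ × T²`
  (`isClassicalScalarTransportOn_Lst`: induction over the stages, gluing the two local pictures
  "nothing moves yet" / "a static profile carried by the moving shear of the last stage",
  `ShearStage.transport_moved_static`);
* **gradient growth** `‖∇(Θ ∘ Φ_φ)‖ ≤ (1 + sup|φ'|) sup‖∇Θ‖` (`norm_gradient_comp_shearMap_le`,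
  chain rule with `‖DΦ̃‖ ≤ 1 + |φ'|`), whence `‖∇Θ_s‖, ‖∇L_m(t)‖ ≤ Λ_s F_s` on the `s`-th slot
  (`norm_gradient_Theta_le`, `norm_gradient_Lst_le`);
* **the dissipation budget** `ν_m ∫₀^{σ_m+T_m} ‖∇L_m‖²_{L²} ≤ 1/m + 1/(m+1)²`
  (`scalarDissipation_Lst_le`: the slots `< m` by lacunarity `track_sum_scale_le_Fq`, the last
  active slot by the choice of `T_m`, `T_mul_le`) — the input of the viscous–inviscid closeness
  estimate (Cheskidov 2023, (4.3));
* the inviscid limit profile `rhoT t = L_n(t)` (`n` large; `rhoT_eq_Lst`), smooth on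
  `(-∞, 1) × T²` (`isSmoothSpaceTimeOn_rhoT`), with `rhoT 0 = ρ_in`.

## References

* A. Cheskidov, *Dissipation anomaly and anomalous dissipation in incompressible fluid flows*,
  arXiv:2311.04182 (2023), §4 (4.3)–(4.5). [`Cheskidov2023`]
-/

open MeasureTheory Set Filter Topology Function UnitAddTorus
open scoped ENNReal NNReal ContDiff InnerProductSpace
open Literature.Analysis.FunctionSpaces.Torus

noncomputable section

namespace Literature.Analysis.FluidPDE

namespace ShearCascade

/-- The flat two-torus (local notation). [folklore] -/
local notation "𝕋²" => UnitAddTorus (Fin 2)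
/-- `ℝ²` (local notation). [folklore] -/
local notation "E²" => EuclideanSpace ℝ (Fin 2)

/-! ## The inviscid profiles of the truncated cascades -/

/-- **The inviscid profile of the `s`-truncated cascade**: `L_0(t) = ρ_in`,
`L_{s+1}(t, x) = L_s(t, x - a_{s+1}(t) Q_{s+1}(x_{u_{s+2}}) e_{u_{s+1}})`. [folklore] -/
def Lst : ℕ → ℝ → 𝕋² → ℝ
  | 0 => fun _ x => rhoIn x
  | s + 1 => ShearStage.moved (Lst s) (dir (s + 1)) (dir (s + 2)) (stQ (s + 1)) (amp (s + 1))

/-- `L_0 = ρ_in`. [folklore] -/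
theorem Lst_zero (t : ℝ) : Lst 0 t = rhoIn := rfl

/-- The recursion for `L_{s+1}`. [folklore] -/
theorem Lst_succ (s : ℕ) (t : ℝ) (x : 𝕋²) :
    Lst (s + 1) t x = Lst s t (shearMap (dir (s + 1)) (dir (s + 2)) (ShearStage.amp (stQ (s + 1)) (amp (s + 1) t)) x) := rfl

/-- **The inviscid profiles are smooth on `ℝ × T²`.** [folklore] -/
theorem isSmoothSpaceTimeOn_Lst (s : ℕ) : FunctionSpaces.Torus.IsSmoothSpaceTimeOn univ (Lst s) := by
  induction s with
  | zero => exact FunctionSpaces.Torus.isSmoothSpaceTimeOn_const isSmooth_rhoIn univ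
  | succ s ih => exact ShearStage.isSmoothSpaceTimeOn_moved ih _ _ _ (contDiff_amp (s + 1))

/-- Slices of the inviscid profiles are smooth. [folklore] -/
theorem isSmooth_Lst (s : ℕ) (t : ℝ) : IsSmooth (Lst s t) := (isSmoothSpaceTimeOn_Lst s).isSmooth_slice (mem_univ t)

/-- **After its last stage the profile is the cascade state**: `L_s(t) = Θ_s` for
`t ≥ σ_s + T_s`. [folklore] -/
theorem Lst_eq_Theta {s : ℕ} {t : ℝ} (ht : σ s + T s ≤ t) : Lst s t = cascadePF.Theta (cascadePF.F extra) s := by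
  induction s with
  | zero => rfl
  | succ s ih =>
    have ht' : σ s + T s ≤ t := by
      have := σ_add_T_lt s
      have := σ_strictMono.monotone (Nat.le_succ s)
      have := T_pos (s + 1)
      linarith
    funext x
    rw [Lst_succ, amp_of_ge ht, ShearStage.shearMap_amp_one, ih ht']
    rfl

/-- **Before its last stage starts the profile is the previous one**: `L_{s+1}(t) = L_s(t)`
for `t ≤ σ_{s+1}`. [folklore] -/
theorem Lst_succ_eq_of_le {s : ℕ} {t : ℝ} (ht : t ≤ σ (s + 1)) : Lst (s + 1) t = Lst s t := by
  funext x
  rw [Lst_succ, amp_of_le ht, ShearStage.shearMap_amp_zero]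

/-- Iterated: `L_n(t) = L_s(t)` for `s ≤ n` and `t ≤ σ_{s+1}`. [folklore] -/
theorem Lst_eq_of_le {s n : ℕ} (hsn : s ≤ n) {t : ℝ} (ht : t ≤ σ (s + 1)) : Lst n t = Lst s t := by
  induction n, hsn using Nat.le_induction with
  | base => rfl
  | succ n hn ih =>
    rw [Lst_succ_eq_of_le (ht.trans (σ_strictMono.monotone (by omega))), ih]

/-! ## The transport equations -/

/-- The velocity of the `s`-truncated cascade at a time after all its stages: zero. [folklore] -/
theorem vel_eq_zero_of_ge {s : ℕ} {t : ℝ} (ht : σ s + T s ≤ t) : vel s t = 0 := by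
  funext x
  rw [vel, Finset.sum_eq_zero]
  · rfl
  · intro r hr
    obtain ⟨h1, h2⟩ := Finset.mem_Icc.1 hr
    rw [stageDrift, deriv_amp_eq_zero, ShearStage.drift_zero]
    · rfl
    · rintro ⟨_, h⟩
      rcases eq_or_lt_of_le h2 with rfl | hlt
      · linarith
      · have := σ_strictMono.monotone (Nat.succ_le_of_lt hlt)
        have := σ_add_T_lt r
        linarith [T_pos s]

/-- The velocity recursion: `vel (s+1) t = vel s t + stageDrift (s+1) t`. [folklore] -/
theorem vel_succ (s : ℕ) (t : ℝ) : vel (s + 1) t = vel s t + stageDrift (s + 1) t := by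
  funext x
  simp only [vel, Pi.add_apply]
  rw [Finset.sum_Icc_succ_top (by omega : 1 ≤ s + 1)]

/-- **The inviscid profiles solve the transport equation of their truncated cascade**, on the
whole time axis. [folklore] -/
theorem isClassicalScalarTransportOn_Lst (s : ℕ) : Torus.IsClassicalScalarTransportOn univ 0 (vel s) (Lst s) := by
  induction s with
  | zero =>
    refine ⟨isSmoothSpaceTimeOn_vel 0, isSmoothSpaceTimeOn_Lst 0, fun t _ x => ?_, fun t _ => isDivFree_vel 0 t⟩
    have hv : vel 0 t = 0 := by funext y; simp [vel]
    rw [hv, zero_mul]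
    simp [FunctionSpaces.Torus.timeDerivWithin, Lst_zero]
  | succ s ih =>
    refine ⟨isSmoothSpaceTimeOn_vel (s + 1), isSmoothSpaceTimeOn_Lst (s + 1), fun t _ x => ?_, fun t _ => isDivFree_vel _ t⟩
    rw [zero_mul]
    by_cases ht : t < σ (s + 1)
    · -- before stage `s+1` starts: the profile and the velocity are those of the `s`-cascade
      have hθ : ∀ᶠ τ in 𝓝 t, Lst (s + 1) τ = Lst s τ := by
        filter_upwards [Iio_mem_nhds ht] with τ hτ using Lst_succ_eq_of_le (le_of_lt hτ)
      have hv : vel (s + 1) t = vel s t := by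
        rw [vel_succ, stageDrift, deriv_amp_eq_zero (fun h => by linarith [h.1]), ShearStage.drift_zero, add_zero]
      rw [ShearStage.transport_congr hθ hv x]
      have := ih.transport t (mem_univ t) x
      rwa [zero_mul] at this
    · -- after stage `s` is over: a static profile carried by the moving shear of stage `s+1`
      push Not at ht
      have hgt : σ s + T s < t := lt_of_lt_of_le (σ_add_T_lt s) ht
      have hθ : ∀ᶠ τ in 𝓝 t, Lst (s + 1) τ =
          ShearStage.moved (fun _ => cascadePF.Theta (cascadePF.F extra) s) (dir (s + 1)) (dir (s + 2)) (stQ (s + 1)) (amp (s + 1)) τ := by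
        filter_upwards [Ioi_mem_nhds hgt] with τ hτ
        funext y
        rw [Lst_succ, ShearStage.moved_apply, Lst_eq_Theta (le_of_lt hτ)]
      have hv : vel (s + 1) t = (fun t => ShearStage.drift (dir (s + 1)) (dir (s + 2)) (stQ (s + 1)) (deriv (amp (s + 1)) t)) t := by
        rw [vel_succ, vel_eq_zero_of_ge hgt.le, zero_add]; rfl
      rw [ShearStage.transport_congr (v₂ := fun t => ShearStage.drift (dir (s + 1)) (dir (s + 2)) (stQ (s + 1)) (deriv (amp (s + 1)) t)) hθ hv x]
      exact ShearStage.transport_moved_static (cascadePF.isSmooth_Theta _ s) (dir_succ_ne (s + 1)).symm _ (contDiff_amp (s + 1)) t x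

/-! ## Gradient growth under a shear -/

/-- The coordinate bound `|w_j| ≤ ‖w‖` in `ℝ²`. [folklore] -/
theorem abs_apply_le_norm (w : E²) (j : Fin 2) : |w j| ≤ ‖w‖ := by
  simpa using PiLp.norm_apply_le w j

/-- **Gradient growth under a shear**: if `‖∇Θ‖ ≤ C` and `|φ'| ≤ M` then
`‖∇(Θ ∘ Φ_φ)‖ ≤ (1 + M) C` (chain rule; `‖DΦ̃‖ ≤ 1 + M`). [folklore] -/
theorem norm_gradient_comp_shearMap_le {Θ : 𝕋² → ℝ} (hΘ : IsSmooth Θ) {C : ℝ} (hC : ∀ x, ‖gradient Θ x‖ ≤ C)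
    (i j : Fin 2) (Q : ShearProfile) {M : ℝ} (hM0 : 0 ≤ M) (hM : ∀ t, |deriv Q t| ≤ M) (x : 𝕋²) :
    ‖gradient (fun y => Θ (shearMap i j Q y)) x‖ ≤ (1 + M) * C := by
  obtain ⟨y, rfl⟩ := proj_surjective x
  have hC0 : 0 ≤ C := (norm_nonneg _).trans (hC (proj y))
  -- the derivative of the shear lift and its norm bound
  have h1 : HasFDerivAt (fun y : E² => y j) (EuclideanSpace.proj j : E² →L[ℝ] ℝ) y :=
    (EuclideanSpace.proj j : E² →L[ℝ] ℝ).hasFDerivAt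
  have h2 : HasDerivAt Q (deriv Q (y j)) (y j) := (Q.contDiff.differentiable (by simp)).differentiableAt.hasDerivAt
  have hφ : HasFDerivAt (fun y : E² => Q (y j)) (deriv Q (y j) • (EuclideanSpace.proj j : E² →L[ℝ] ℝ)) y :=
    h2.comp_hasFDerivAt y h1
  set L : E² →L[ℝ] E² := ContinuousLinearMap.id ℝ E² -
    (deriv Q (y j) • (EuclideanSpace.proj j : E² →L[ℝ] ℝ)).smulRight (EuclideanSpace.single i (1 : ℝ)) with hL_def
  have hL : HasFDerivAt (shearMapLift i j Q) L y := by
    unfold shearMapLift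
    exact (hasFDerivAt_id y).sub (hφ.smul_const _)
  have hLb : ∀ w : E², ‖L w‖ ≤ (1 + M) * ‖w‖ := by
    intro w
    have hw : L w = w - (deriv Q (y j) * w j) • EuclideanSpace.single i (1 : ℝ) := by
      simp [hL_def]
    rw [hw]
    calc ‖w - (deriv Q (y j) * w j) • EuclideanSpace.single i (1 : ℝ)‖
        ≤ ‖w‖ + ‖(deriv Q (y j) * w j) • EuclideanSpace.single i (1 : ℝ)‖ := norm_sub_le _ _
      _ = ‖w‖ + |deriv Q (y j)| * |w j| := by
          rw [norm_smul, PiLp.norm_single, norm_one, mul_one, Real.norm_eq_abs, abs_mul]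
      _ ≤ ‖w‖ + M * ‖w‖ := by
          gcongr
          · exact hM _
          · exact abs_apply_le_norm w j
      _ = (1 + M) * ‖w‖ := by ring
  -- the gradient of the composition
  set g : E² := gradient (fun z => Θ (shearMap i j Q z)) (proj y) with hg_def
  have hΘd : Differentiable ℝ (lift Θ) := hΘ.differentiable (by simp)
  have hlift : lift (fun z => Θ (shearMap i j Q z)) = lift Θ ∘ shearMapLift i j Q := by
    funext y'
    simp only [lift_apply, Function.comp_apply, shearMap_proj]
  have key : ‖g‖ ^ 2 ≤ (1 + M) * C * ‖g‖ := by
    rw [← real_inner_self_eq_norm_sq, FunctionSpaces.Torus.inner_gradient_left, ← fderiv_lift, hlift,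
      fderiv_comp y (hΘd _) hL.differentiableAt, hL.fderiv, ContinuousLinearMap.comp_apply, fderiv_lift,
      ← FunctionSpaces.Torus.inner_gradient_left]
    calc ⟪gradient Θ (proj (shearMapLift i j Q y)), L g⟫_ℝ ≤ ‖gradient Θ (proj (shearMapLift i j Q y))‖ * ‖L g‖ :=
          real_inner_le_norm _ _
      _ ≤ C * ((1 + M) * ‖g‖) := mul_le_mul (hC _) (hLb g) (norm_nonneg _) hC0
      _ = (1 + M) * C * ‖g‖ := by ring
  have hK : 0 ≤ (1 + M) * C := by positivity
  nlinarith [key, norm_nonneg g, hK]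

/-- The same for an amplitude-scaled profile `c φ`, `0 ≤ c ≤ 1`. [folklore] -/
theorem norm_gradient_comp_shearMap_amp_le {Θ : 𝕋² → ℝ} (hΘ : IsSmooth Θ) {C : ℝ} (hC : ∀ x, ‖gradient Θ x‖ ≤ C)
    (i j : Fin 2) (Q : ShearProfile) {M : ℝ} (hM0 : 0 ≤ M) (hM : ∀ t, |deriv Q t| ≤ M) {c : ℝ} (hc : c ∈ Icc (0 : ℝ) 1)
    (x : 𝕋²) : ‖gradient (fun y => Θ (shearMap i j (ShearStage.amp Q c) y)) x‖ ≤ (1 + M) * C := by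
  refine norm_gradient_comp_shearMap_le hΘ hC i j _ hM0 (fun t => ?_) x
  have h : deriv (ShearStage.amp Q c) t = c * deriv Q t := by
    have hfun : ((ShearStage.amp Q c : ShearProfile) : ℝ → ℝ) = fun t => c * Q t := funext (ShearStage.amp_apply Q c)
    rw [hfun, deriv_const_mul _ ((Q.contDiff.differentiable (by simp)).differentiableAt)]
  rw [h, abs_mul, abs_of_nonneg hc.1]
  calc c * |deriv Q t| ≤ 1 * M := mul_le_mul hc.2 (hM t) (abs_nonneg _) zero_le_one
    _ = M := one_mul M

/-! ## Gradient bounds along the cascade -/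

/-- The first derivative of a scaled profile. [folklore] -/
theorem deriv_scale (S : ShearProfile) (D : ℝ) (F : ℕ) (t : ℝ) : deriv (S.scale D F) t = D * F * deriv S (F * t) := by
  have hS : HasDerivAt S (deriv S (F * t)) (F * t) := ((S.contDiff.differentiable (by simp)).differentiableAt).hasDerivAt
  have h : HasDerivAt (fun t => D * S (F * t)) (D * (deriv S (F * t) * F)) t :=
    (hS.comp t ((hasDerivAt_id t).const_mul (F : ℝ) |>.congr_deriv (by simp))).const_mul D
  have hfun : (S.scale D F : ℝ → ℝ) = fun t => D * S (F * t) := funext fun t => S.scale_apply D F t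
  rw [hfun, h.deriv]; ring

/-- **Bound of the first derivative of the stage profile**: `|Q_s'| ≤ D_s F_s L1_s`. [folklore] -/
theorem abs_deriv_stQ_le (s : ℕ) (t : ℝ) : |deriv (stQ s) t| ≤ Ds s * Fq s * L1 s := by
  unfold stQ ProfileFamily.stP ProfileFamily.stageProfile
  rw [deriv_scale, abs_mul, abs_mul]
  have hD : |disp (cascadePF.F extra) s| = Ds s := abs_of_pos (Ds_pos s)
  have hF : |((cascadePF.F extra s : ℕ) : ℝ)| = Fq s := abs_of_nonneg (Nat.cast_nonneg _)
  rw [hD, hF]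
  exact mul_le_mul_of_nonneg_left ((L1_spec s).2 _) (by have := Ds_pos s; positivity)

/-- The growth factor of stage `s+1` fits the constants: `(1 + D_{s+1} F_{s+1} L1_{s+1}) Λ_s F_s ≤ Λ_{s+1} F_{s+1}`. [folklore] -/
theorem growth_le (s : ℕ) : (1 + Ds (s + 1) * Fq (s + 1) * L1 (s + 1)) * (Λ s * Fq s) ≤ Λ (s + 1) * Fq (s + 1) := by
  rw [Λ_succ, Ds_eq, Nat.add_sub_cancel]
  have hF : (Fq s : ℝ) ≤ Fq (s + 1) := by exact_mod_cast cascadePF.F_mono extra (Nat.le_succ s)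
  have hFs := Fq_pos s
  have hΛ := Λ_nonneg s
  have hL := (L1_spec (s + 1)).1
  have e : (1 + 1 / (2 * (Fq s : ℝ)) * Fq (s + 1) * L1 (s + 1)) * (Λ s * Fq s) = Λ s * (Fq s + Fq (s + 1) * L1 (s + 1) / 2) := by
    field_simp
  rw [e, mul_assoc]
  refine mul_le_mul_of_nonneg_left ?_ hΛ
  have hFL : (0 : ℝ) ≤ Fq (s + 1) * L1 (s + 1) := by positivity
  nlinarith

/-- `F_0 = 1` as a real number. [folklore] -/
theorem Fq_zero : (Fq 0 : ℝ) = 1 := by unfold Fq; rw [cascadePF.F_zero]; simp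

/-- **The cascade states have gradients `≤ Λ_s F_s`.** [folklore] -/
theorem norm_gradient_Theta_le (s : ℕ) (x : 𝕋²) : ‖gradient (cascadePF.Theta (cascadePF.F extra) s) x‖ ≤ Λ s * Fq s := by
  induction s generalizing x with
  | zero =>
    rw [Fq_zero, mul_one]
    exact (Γ₀_spec.2 x).trans (Γ₀_le_Λ 0)
  | succ s ih =>
    have hDFL : 0 ≤ Ds (s + 1) * Fq (s + 1) * L1 (s + 1) := by
      have := Ds_pos (s + 1); have := (L1_spec (s + 1)).1; positivity
    refine le_trans ?_ (growth_le s)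
    exact norm_gradient_comp_shearMap_le (cascadePF.isSmooth_Theta _ s) ih _ _ _ hDFL (abs_deriv_stQ_le (s + 1)) x

/-- **Gradients of the moving profile during and after stage `s+1`**: for `t ≥ σ_{s+1}`,
`‖∇L_{s+1}(t)‖ ≤ Λ_{s+1} F_{s+1}`. [folklore] -/
theorem norm_gradient_Lst_succ_le (s : ℕ) {t : ℝ} (ht : σ (s + 1) ≤ t) (x : 𝕋²) :
    ‖gradient (Lst (s + 1) t) x‖ ≤ Λ (s + 1) * Fq (s + 1) := by
  have hstat : Lst s t = cascadePF.Theta (cascadePF.F extra) s := Lst_eq_Theta ((σ_add_T_lt s).le.trans ht)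
  have hfun : Lst (s + 1) t = fun y => cascadePF.Theta (cascadePF.F extra) s
      (shearMap (dir (s + 1)) (dir (s + 2)) (ShearStage.amp (stQ (s + 1)) (amp (s + 1) t)) y) := by
    funext y; rw [Lst_succ, hstat]
  rw [hfun]
  have hDFL : 0 ≤ Ds (s + 1) * Fq (s + 1) * L1 (s + 1) := by
    have := Ds_pos (s + 1); have := (L1_spec (s + 1)).1; positivity
  refine le_trans ?_ (growth_le s)
  exact norm_gradient_comp_shearMap_amp_le (cascadePF.isSmooth_Theta _ s) (norm_gradient_Theta_le s) _ _ _ hDFL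
    (abs_deriv_stQ_le (s + 1)) (amp_mem_Icc (s + 1) t) x

/-- **Gradient bound on the `k`-th slot**: for `k ≤ m`, `t ≤ σ_{k+1}` and (`k = 0` or `σ_k ≤ t`),
`‖∇L_m(t)‖ ≤ Λ_k F_k`. [folklore] -/
theorem norm_gradient_Lst_le {k m : ℕ} (hkm : k ≤ m) {t : ℝ} (hlo : k = 0 ∨ σ k ≤ t) (hhi : t ≤ σ (k + 1)) (x : 𝕋²) :
    ‖gradient (Lst m t) x‖ ≤ Λ k * Fq k := by
  rw [Lst_eq_of_le hkm hhi]
  cases k with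
  | zero =>
    rw [Lst_zero, Fq_zero, mul_one]
    exact (Γ₀_spec.2 x).trans (Γ₀_le_Λ 0)
  | succ s =>
    have hlo' : σ (s + 1) ≤ t := by
      rcases hlo with h | h
      · exact absurd h (Nat.succ_ne_zero s)
      · exact h
    exact norm_gradient_Lst_succ_le s hlo' x

/-! ## The dissipation budget of the inviscid profile up to the end of the last slot -/

/-- **The gradient energy on the `k`-th slot**: `‖∇L_m(t)‖²_{L²} ≤ (Λ_k F_k)²`. [folklore] -/
theorem scalarGradNormSq_Lst_le {k m : ℕ} (hkm : k ≤ m) {t : ℝ} (hlo : k = 0 ∨ σ k ≤ t) (hhi : t ≤ σ (k + 1)) :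
    Torus.scalarGradNormSq (Lst m t) ≤ (Λ k * Fq k) ^ 2 := by
  unfold Torus.scalarGradNormSq
  calc ∫ x, ‖gradient (Lst m t) x‖ ^ 2 ≤ ∫ _ : 𝕋², (Λ k * Fq k) ^ 2 :=
        integral_mono (integrable_norm_sq_of_continuous (isSmooth_Lst m t).gradient.continuous) (integrable_const _)
          fun x => pow_le_pow_left₀ (norm_nonneg _) (norm_gradient_Lst_le hkm hlo hhi x) 2
    _ = (Λ k * Fq k) ^ 2 := by simp

/-- The gradient energy of the inviscid profile is continuous in time. [folklore] -/
theorem continuous_scalarGradNormSq_Lst (m : ℕ) : Continuous fun t => Torus.scalarGradNormSq (Lst m t) := by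
  rw [← continuousOn_univ]
  exact (isClassicalScalarTransportOn_Lst m).continuousOn_scalarGradNormSq convex_univ uniqueDiffOn_univ

/-- `σ 0 = 0`. [folklore] -/
theorem σ_zero : σ 0 = 0 := by norm_num [σ]

/-- **The slot-wise dissipation budget**: `∫_{σ_k}^{σ_{k+1}} ‖∇L_m‖² ≤ (T_k + P_k)(Λ_k F_k)²`
for `k < m`. [folklore] -/
theorem integral_slot_le {k m : ℕ} (hkm : k < m) :
    ∫ t in σ k..σ (k + 1), Torus.scalarGradNormSq (Lst m t) ≤ (T k + P k) * (Λ k * Fq k) ^ 2 := by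
  have hle : σ k ≤ σ (k + 1) := (σ_strictMono (Nat.lt_succ_self k)).le
  have h := intervalIntegral.norm_integral_le_of_norm_le_const (a := σ k) (b := σ (k + 1)) (C := (Λ k * Fq k) ^ 2)
    (f := fun t => Torus.scalarGradNormSq (Lst m t)) fun t ht => by
      rw [uIoc_of_le hle] at ht
      rw [Real.norm_eq_abs, abs_of_nonneg (Torus.scalarGradNormSq_nonneg _)]
      exact scalarGradNormSq_Lst_le hkm.le (by
        rcases Nat.eq_zero_or_pos k with h0 | h0
        · exact Or.inl h0
        · exact Or.inr ht.1.le) ht.2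
  have e : σ (k + 1) - σ k = T k + P k := by rw [σ_succ]; ring
  rw [Real.norm_eq_abs, e, abs_of_pos (by linarith [T_pos k, P_pos k] : 0 < T k + P k)] at h
  linarith [le_abs_self (∫ t in σ k..σ (k + 1), Torus.scalarGradNormSq (Lst m t))]

/-- **The last (partial) slot**: `∫_{σ_m}^{σ_m + T_m} ‖∇L_m‖² ≤ T_m (Λ_m F_m)²`. [folklore] -/
theorem integral_last_slot_le (m : ℕ) :
    ∫ t in σ m..σ m + T m, Torus.scalarGradNormSq (Lst m t) ≤ T m * (Λ m * Fq m) ^ 2 := by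
  have hle : σ m ≤ σ m + T m := by linarith [T_pos m]
  have h := intervalIntegral.norm_integral_le_of_norm_le_const (a := σ m) (b := σ m + T m) (C := (Λ m * Fq m) ^ 2)
    (f := fun t => Torus.scalarGradNormSq (Lst m t)) fun t ht => by
      rw [uIoc_of_le hle] at ht
      rw [Real.norm_eq_abs, abs_of_nonneg (Torus.scalarGradNormSq_nonneg _)]
      exact scalarGradNormSq_Lst_le le_rfl (by
        rcases Nat.eq_zero_or_pos m with h0 | h0
        · exact Or.inl h0
        · exact Or.inr ht.1.le) (ht.2.trans (σ_add_T_lt m).le)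
  rw [Real.norm_eq_abs, show σ m + T m - σ m = T m by ring, abs_of_pos (T_pos m)] at h
  linarith [le_abs_self (∫ t in σ m..σ m + T m, Torus.scalarGradNormSq (Lst m t))]

/-- **The total gradient budget up to the end of the last slot**:
`∫₀^{σ_m+T_m} ‖∇L_m‖² ≤ Σ_{k<m} (T_k+P_k)(Λ_kF_k)² + T_m(Λ_mF_m)²`. [folklore] -/
theorem integral_scalarGradNormSq_Lst_le (m : ℕ) :
    ∫ t in (0 : ℝ)..σ m + T m, Torus.scalarGradNormSq (Lst m t) ≤
      ∑ k ∈ Finset.range m, (T k + P k) * (Λ k * Fq k) ^ 2 + T m * (Λ m * Fq m) ^ 2 := by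
  have hint : ∀ a b, IntervalIntegrable (fun t => Torus.scalarGradNormSq (Lst m t)) volume a b := fun a b =>
    (continuous_scalarGradNormSq_Lst m).intervalIntegrable a b
  have hsum := intervalIntegral.sum_integral_adjacent_intervals (f := fun t => Torus.scalarGradNormSq (Lst m t))
    (a := σ) (n := m) fun k _ => hint _ _
  rw [σ_zero] at hsum
  rw [← intervalIntegral.integral_add_adjacent_intervals (hint 0 (σ m)) (hint (σ m) (σ m + T m)), ← hsum]
  exact add_le_add (Finset.sum_le_sum fun k hk => integral_slot_le (Finset.mem_range.1 hk)) (integral_last_slot_le m)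

/-- **The dissipation budget**: `ν_m ∫₀^{σ_m+T_m} ‖∇L_m‖² ≤ 1/m + 1/(m+1)²` for `m ≥ 1` — the
frequencies were chosen for this (`track_sum_scale_le_Fq`, `T_mul_le`). [folklore] -/
theorem scalarDissipation_Lst_le {m : ℕ} (hm : 1 ≤ m) :
    Torus.scalarDissipation (ν m) (Lst m) 0 (σ m + T m) ≤ 1 / m + 1 / (m + 1) ^ 2 := by
  unfold Torus.scalarDissipation
  have hν := (ν_pos m).le
  refine (mul_le_mul_of_nonneg_left (integral_scalarGradNormSq_Lst_le m) hν).trans ?_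
  rw [mul_add]
  refine add_le_add ?_ ?_
  · -- the earlier slots: lacunarity
    have hF := track_sum_scale_le_Fq hm
    have hFm := Fq_pos m
    have hFm1 := Fq_pos (m - 1)
    have hμ := μ_nonneg m
    set X : ℝ := ∑ r ∈ Finset.range m, (T r + P r + 1) * Λ r ^ 2 with hX
    have hX0 : 0 ≤ X := Finset.sum_nonneg fun r _ => by have := T_pos r; have := P_pos r; positivity
    -- each term: `(T_k+P_k) Λ_k² F_k² ≤ (T_k+P_k+1) Λ_k² F_{m-1}²`
    have hterm : ∑ k ∈ Finset.range m, (T k + P k) * (Λ k * Fq k) ^ 2 ≤ X * (Fq (m - 1) : ℝ) ^ 2 := by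
      rw [hX, Finset.sum_mul]
      refine Finset.sum_le_sum fun k hk => ?_
      have hk : k ≤ m - 1 := by have := Finset.mem_range.1 hk; omega
      have hFk : (Fq k : ℝ) ≤ Fq (m - 1) := by exact_mod_cast cascadePF.F_mono extra hk
      have hFk0 := (Fq_pos k).le
      have hT := (T_pos k).le; have hP := (P_pos k).le
      have hΛ2 : 0 ≤ Λ k ^ 2 := sq_nonneg _
      calc (T k + P k) * (Λ k * Fq k) ^ 2 = (T k + P k) * Λ k ^ 2 * (Fq k : ℝ) ^ 2 := by ring
        _ ≤ (T k + P k + 1) * Λ k ^ 2 * (Fq (m - 1) : ℝ) ^ 2 :=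
            mul_le_mul (mul_le_mul_of_nonneg_right (by linarith) hΛ2) (pow_le_pow_left₀ hFk0 hFk 2) (by positivity)
              (by positivity)
    calc ν m * ∑ k ∈ Finset.range m, (T k + P k) * (Λ k * Fq k) ^ 2 ≤ ν m * (X * (Fq (m - 1) : ℝ) ^ 2) :=
          mul_le_mul_of_nonneg_left hterm hν
      _ = μ m * X * ((Fq (m - 1) : ℝ) / Fq m) ^ 2 := by unfold ν; field_simp
      _ ≤ μ m * X * ((Fq (m - 1) : ℝ) / Fq m) := by
          have hr1 : (Fq (m - 1) : ℝ) / Fq m ≤ 1 := by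
            rw [div_le_one hFm]; exact_mod_cast cascadePF.F_mono extra (Nat.sub_le m 1)
          have hr0 : 0 ≤ (Fq (m - 1) : ℝ) / Fq m := by positivity
          have : ((Fq (m - 1) : ℝ) / Fq m) ^ 2 ≤ (Fq (m - 1) : ℝ) / Fq m := by
            rw [sq]; exact mul_le_of_le_one_left hr0 hr1
          exact mul_le_mul_of_nonneg_left this (by positivity)
      _ = (Fq (m - 1) : ℝ) * (m * μ m * (1 + X)) / (m * Fq m) * (X / (1 + X)) := by
          have hm0 : (0 : ℝ) < m := by exact_mod_cast hm
          field_simp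
      _ ≤ (Fq m : ℝ) / (m * Fq m) * (X / (1 + X)) := by
          have hm0 : (0 : ℝ) < m := by exact_mod_cast hm
          gcongr
      _ ≤ 1 / m := by
          have hm0 : (0 : ℝ) < m := by exact_mod_cast hm
          rw [div_mul_eq_mul_div]
          rw [div_le_div_iff₀ (by positivity) hm0]
          have h1 : X / (1 + X) ≤ 1 := by rw [div_le_one (by positivity)]; linarith
          calc (Fq m : ℝ) * (X / (1 + X)) * m ≤ (Fq m : ℝ) * 1 * m := by gcongr
            _ = 1 * (m * Fq m) := by ring
  · -- the last slot: the choice of `T_m`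
    have hT := T_mul_le m
    have hFm := Fq_pos m
    calc ν m * (T m * (Λ m * Fq m) ^ 2) = T m * (μ m * Λ m ^ 2) := by unfold ν; field_simp
      _ = T m * ((m + 1) ^ 2 * μ m * Λ m ^ 2) / (m + 1) ^ 2 := by field_simp
      _ ≤ 1 / (m + 1) ^ 2 := by gcongr

/-! ## The inviscid limit profile -/

open Classical in
/-- The index of the slot containing `t < 1` (the least `n` with `t < σ_{n+1}`), `0` for `t ≥ 1`. [folklore] -/
def Nst (t : ℝ) : ℕ := if h : ∃ n, t < σ (n + 1) then Nat.find h else 0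

/-- For `t < 1` there is a slot index. [folklore] -/
theorem exists_lt_σ {t : ℝ} (ht : t < 1) : ∃ n, t < σ (n + 1) := by
  obtain ⟨n, hn⟩ := ((tendsto_σ.eventually (Ioi_mem_nhds ht))).exists
  exact ⟨n, lt_trans hn (σ_strictMono (Nat.lt_succ_self n))⟩

/-- `t < σ_{Nst t + 1}` for `t < 1`. [folklore] -/
theorem lt_σ_Nst {t : ℝ} (ht : t < 1) : t < σ (Nst t + 1) := by
  classical
  rw [Nst, dif_pos (exists_lt_σ ht)]
  exact Nat.find_spec (exists_lt_σ ht)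

/-- `Nst t ≤ n` whenever `t < σ_{n+1}`. [folklore] -/
theorem Nst_le {n : ℕ} {t : ℝ} (ht : t < σ (n + 1)) : Nst t ≤ n := by
  classical
  have h : ∃ n, t < σ (n + 1) := ⟨n, ht⟩
  rw [Nst, dif_pos h]
  exact Nat.find_min' h ht

/-- **The inviscid limit profile** `ρ̃(t) = L_{Nst t}(t)`: the common value of all `L_n(t)`,
`n` large, for `t < 1`. [folklore] -/
def rhoT (t : ℝ) : 𝕋² → ℝ := Lst (Nst t) t

/-- **Local representation**: `ρ̃(t) = L_n(t)` whenever `t < σ_{n+1}`. [folklore] -/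
theorem rhoT_eq_Lst {n : ℕ} {t : ℝ} (ht : t < σ (n + 1)) : rhoT t = Lst n t := by
  have h1 : t < 1 := ht.trans (σ_lt_one _)
  rw [rhoT, Lst_eq_of_le (Nst_le ht) (lt_σ_Nst h1).le]

/-- **The inviscid limit profile is smooth on `(-∞, 1) × T²`.** [folklore] -/
theorem isSmoothSpaceTimeOn_rhoT : FunctionSpaces.Torus.IsSmoothSpaceTimeOn (Iio 1) rhoT := by
  intro p hp
  obtain ⟨ht, -⟩ := Set.mem_prod.1 hp
  obtain ⟨n, hn⟩ := exists_lt_σ (mem_Iio.1 ht)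
  have hsm : ContDiff ℝ ∞ (FunctionSpaces.Torus.stLift (Lst n)) := by
    have := isSmoothSpaceTimeOn_Lst n
    unfold FunctionSpaces.Torus.IsSmoothSpaceTimeOn at this
    rwa [Set.univ_prod_univ, contDiffOn_univ] at this
  have heq : FunctionSpaces.Torus.stLift rhoT =ᶠ[𝓝 p] FunctionSpaces.Torus.stLift (Lst n) := by
    have hopen : IsOpen ((Iio (σ (n + 1))) ×ˢ (univ : Set E²)) := isOpen_Iio.prod isOpen_univ
    filter_upwards [hopen.mem_nhds (Set.mem_prod.2 ⟨hn, mem_univ _⟩)] with q hq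
    obtain ⟨hq1, -⟩ := Set.mem_prod.1 hq
    simp only [FunctionSpaces.Torus.stLift]
    rw [rhoT_eq_Lst (mem_Iio.1 hq1)]
  exact (hsm.contDiffAt.congr_of_eventuallyEq heq).contDiffWithinAt

/-- Slices of the limit profile are smooth (everywhere: for `t ≥ 1` it is some `L_n(t)`). [folklore] -/
theorem isSmooth_rhoT (t : ℝ) : IsSmooth (rhoT t) := isSmooth_Lst _ t

/-- `ρ̃(0) = ρ_in`. [folklore] -/
theorem rhoT_zero : rhoT 0 = rhoIn := by
  rw [rhoT_eq_Lst (n := 0) (by rw [σ_one]; norm_num), Lst_zero]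

/-- `L_m(0) = ρ_in`. [folklore] -/
theorem Lst_at_zero (m : ℕ) : Lst m 0 = rhoIn := by
  rw [Lst_eq_of_le (Nat.zero_le m) (by rw [σ_one]; norm_num), Lst_zero]

end ShearCascade

end Literature.Analysis.FluidPDE
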